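/-
Copyright: derived here (Resolution Observatory cell `pub-rosobs`, carver gen 57). AI-written Lean; AI review is weaker than expert
review.  Companion file of the cell's POLYNOMIAL weighted-centre model `W(f)`: BASE CHANGE `k → R` (cell: `R = k⟦s⟧`) of a
substitution `Φ` of `k[ε][σ]` to `Φ_R` on `R[ε][σ]` — isotropy, gradedness, `≡ id (mod σ)` and pure vectors are preserved —
the first step of engine 1's LEMMA FC (B3) ("consider the isotropies `Φ_τ, Φ_{t(s)τ}, Φ_{sτ}` of `g` over `R[τ]`";
THEOREM-FC-eng1-g37 §1 (F2), §4 (B3)).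
Instrument — NOT a resolution theorem and NOT a statement about the invariant of [AbramovichTemkinWlodarczyk2024].
-/
import Literature.AlgebraicGeometry.Resolution.WeightedCentreGradedIsotropy
import Literature.AlgebraicGeometry.Resolution.WeightedCentrePureVectors
import Mathlib.Algebra.MvPolynomial.Eval
import HarnessLib

/-!
# Base change of substitutions `Φ ↦ Φ_R`

Uniform value line: INSTRUMENT — kernel-checked bookkeeping for the polynomial weighted-centre model `W(f)` of the cell
(engine 1's toy model: THEOREM-FC-eng1-g37 §4 (B3)) — NOT a resolution theorem, NOT a statement about the
Abramovich–Temkin–Włodarczyk invariant, NOT summit progress; AI-written Lean, AI review is weaker than expert review.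
(Unrelated to `WeightedCentreBaseChange`, which is the base change of CENTRES `W_k(f) ⊆ W_K(f ⊗ K)`.)

Setting of `WeightedCentreIsotropyTwist` / `WeightedCentreGradedIsotropy` / `WeightedCentrePureVectors`: a substitution is a ring
endomorphism `Φ` of `k[ε][σ] = (MvPolynomial ι k)[X]` fixing the scalars `C (C c)` and `σ`, determined by `Φ(ε_i) = ε_i + A_i(σ, ε)`.
For a ring map `φ : k →+* R` (cell: `k ⊂ k⟦s⟧`) write `(·)^φ := Polynomial.map (MvPolynomial.map φ) : k[ε][σ] → R[ε][σ]`.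

* `substBaseChange φ Φ = Φ_R`: the ring endomorphism of `R[ε][σ]` fixing `C (C r)` and `σ` with `Φ_R(ε_i) = (Φ ε_i)^φ`;
  `Φ_R ∘ (·)^φ = (·)^φ ∘ Φ` (`substBaseChange_map`); `(Φ Ψ)_R = Φ_R Ψ_R`, `id_R = id` (so inverses base-change);
* preserved: isotropy (`Φ (C g) = C g ⇒ Φ_R (C g^φ) = C g^φ`, `isIsotropyOf_substBaseChange`), `≡ id (mod σ)`
  (`substBaseChange_sub_self_mem`), gradedness for the same weights (`isGradedHom_substBaseChange`; `isTW_map`);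
* pure vectors: `pureVec Φ_R i = (pureVec Φ i).map φ` (`pureVec_substBaseChange`), so pure-free slots stay pure-free and, for
  `φ` injective, non-zero pure coefficients stay non-zero; component operators: `(Φ_R (C a^φ))_n = ((Φ (C a))_n)^φ`
  (`coeff_substBaseChange_C_map`) and the DESCENT `(Φ_R (C a^φ))_n = 0 ⇒ (Φ (C a))_n = 0` for `φ` injective
  (`coeff_map_C_eq_zero_of_substBaseChange`) — used after LEMMA FC (B5) to return from `R[ε]` to `k[ε]` (B6).

What is NOT here (engine 1's modelling): the rescalings `Φ_{λσ}` (`WeightedCentreSigmaRescaling`), the branch and `u_k`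
(`WeightedCentreFermatBranch`), LEMMA CP / PR″, the hypotheses (H1)/(H>)/(Hmax), (B4).

Pattern cites: substitution endomorphisms and the `mod σ` calculus [cite: SerreLocalFields1979, Ch. II §4 Lemma 1]; weighted gradings
[cite: AbramovichTemkinWlodarczyk2024, Thm. 5.3.1 (2)–(3) (p. 1578)].  Formalisation and statements ours, elementary.
-/

namespace Literature.AlgebraicGeometry.Resolution.WeightedBlowup

open Polynomial

section SubstBaseChange

variable {k : Type*} [CommRing k] {R : Type*} [CommRing R] (φ : k →+* R) {ι : Type*}

/-- Two ring maps out of `R[ε][σ]` agreeing on `C (C r)`, `C (ε_i)` and `σ` are equal (plumbing).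
[cite: SerreLocalFields1979, Ch. II §4 Lemma 1] -/
theorem ringHom_ext_CC_CX_X {B : Type*} [Semiring B] {Γ Γ' : (MvPolynomial ι R)[X] →+* B}
    (hC : ∀ r : R, Γ (C (MvPolynomial.C r)) = Γ' (C (MvPolynomial.C r)))
    (hXi : ∀ i, Γ (C (MvPolynomial.X i)) = Γ' (C (MvPolynomial.X i))) (hX : Γ X = Γ' X) : Γ = Γ' :=
  Polynomial.ringHom_ext (fun a => RingHom.congr_fun (MvPolynomial.ringHom_ext (f := Γ.comp C) (g := Γ'.comp C) hC hXi) a) hX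

/-- The **base change** `Φ_R` of a substitution `Φ` of `k[ε][σ]` along `φ : k → R`: `Φ_R (C (C r)) = C (C r)`, `Φ_R σ = σ`,
`Φ_R (C ε_i) = (Φ (C ε_i))^φ` (construction, ours). [cite: SerreLocalFields1979, Ch. II §4 Lemma 1] -/
noncomputable def substBaseChange (Φ : (MvPolynomial ι k)[X] →+* (MvPolynomial ι k)[X]) :
    (MvPolynomial ι R)[X] →+* (MvPolynomial ι R)[X] :=
  eval₂RingHom (MvPolynomial.eval₂Hom (C.comp MvPolynomial.C)
    fun i => (Φ (C (MvPolynomial.X i))).map (MvPolynomial.map φ)) X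

/-- `Φ_R σ = σ` (plumbing). [cite: SerreLocalFields1979, Ch. II §4 Lemma 1] -/
@[simp] theorem substBaseChange_X (Φ : (MvPolynomial ι k)[X] →+* (MvPolynomial ι k)[X]) : substBaseChange φ Φ X = X := by
  rw [substBaseChange, coe_eval₂RingHom, eval₂_X]

/-- `Φ_R` fixes the scalars `R` (plumbing). [cite: SerreLocalFields1979, Ch. II §4 Lemma 1] -/
@[simp] theorem substBaseChange_C_C (Φ : (MvPolynomial ι k)[X] →+* (MvPolynomial ι k)[X]) (r : R) :
    substBaseChange φ Φ (C (MvPolynomial.C r)) = C (MvPolynomial.C r) := by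
  rw [substBaseChange, coe_eval₂RingHom, eval₂_C, MvPolynomial.eval₂Hom_C, RingHom.comp_apply]

/-- `Φ_R (C ε_i) = (Φ (C ε_i))^φ` (plumbing). [cite: SerreLocalFields1979, Ch. II §4 Lemma 1] -/
theorem substBaseChange_C_X (Φ : (MvPolynomial ι k)[X] →+* (MvPolynomial ι k)[X]) (i : ι) :
    substBaseChange φ Φ (C (MvPolynomial.X i)) = (Φ (C (MvPolynomial.X i))).map (MvPolynomial.map φ) := by
  rw [substBaseChange, coe_eval₂RingHom, eval₂_C, MvPolynomial.eval₂Hom_X']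

/-- **`Φ_R ∘ (·)^φ = (·)^φ ∘ Φ`** for `Φ` fixing scalars and `σ` (ours). [cite: SerreLocalFields1979, Ch. II §4 Lemma 1] -/
theorem substBaseChange_comp_mapRingHom (Φ : (MvPolynomial ι k)[X] →+* (MvPolynomial ι k)[X]) (hX : Φ X = X)
    (hC : ∀ c : k, Φ (C (MvPolynomial.C c)) = C (MvPolynomial.C c)) :
    (substBaseChange φ Φ).comp (mapRingHom (MvPolynomial.map φ)) = (mapRingHom (MvPolynomial.map φ)).comp Φ := by
  refine ringHom_ext_CC_CX_X (fun c => ?_) (fun i => ?_) ?_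
  · rw [RingHom.comp_apply, RingHom.comp_apply, coe_mapRingHom, Polynomial.map_C, MvPolynomial.map_C, substBaseChange_C_C, hC,
      Polynomial.map_C, MvPolynomial.map_C]
  · rw [RingHom.comp_apply, RingHom.comp_apply, coe_mapRingHom, Polynomial.map_C, MvPolynomial.map_X, substBaseChange_C_X]
  · rw [RingHom.comp_apply, RingHom.comp_apply, coe_mapRingHom, Polynomial.map_X, substBaseChange_X, hX, Polynomial.map_X]

/-- … pointwise: `Φ_R (f^φ) = (Φ f)^φ` (ours). [cite: SerreLocalFields1979, Ch. II §4 Lemma 1] -/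
theorem substBaseChange_map (Φ : (MvPolynomial ι k)[X] →+* (MvPolynomial ι k)[X]) (hX : Φ X = X)
    (hC : ∀ c : k, Φ (C (MvPolynomial.C c)) = C (MvPolynomial.C c)) (f : (MvPolynomial ι k)[X]) :
    substBaseChange φ Φ (f.map (MvPolynomial.map φ)) = (Φ f).map (MvPolynomial.map φ) := by
  have h := RingHom.congr_fun (substBaseChange_comp_mapRingHom φ Φ hX hC) f
  rwa [RingHom.comp_apply, RingHom.comp_apply, coe_mapRingHom] at h

/-- `(id)_R = id` (plumbing). [cite: SerreLocalFields1979, Ch. II §4 Lemma 1] -/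
theorem substBaseChange_id : substBaseChange φ (RingHom.id (MvPolynomial ι k)[X]) = RingHom.id (MvPolynomial ι R)[X] :=
  ringHom_ext_CC_CX_X (fun r => by rw [substBaseChange_C_C, RingHom.id_apply])
    (fun i => by rw [substBaseChange_C_X, RingHom.id_apply, Polynomial.map_C, MvPolynomial.map_X, RingHom.id_apply])
    (by rw [substBaseChange_X, RingHom.id_apply])

/-- **`(Φ ∘ Ψ)_R = Φ_R ∘ Ψ_R`** for `Φ` fixing scalars and `σ` (ours). [cite: SerreLocalFields1979, Ch. II §4 Lemma 1] -/
theorem substBaseChange_comp (Φ Ψ : (MvPolynomial ι k)[X] →+* (MvPolynomial ι k)[X]) (hX : Φ X = X)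
    (hC : ∀ c : k, Φ (C (MvPolynomial.C c)) = C (MvPolynomial.C c)) :
    substBaseChange φ (Φ.comp Ψ) = (substBaseChange φ Φ).comp (substBaseChange φ Ψ) :=
  ringHom_ext_CC_CX_X (fun r => by rw [substBaseChange_C_C, RingHom.comp_apply, substBaseChange_C_C, substBaseChange_C_C])
    (fun i => by
      rw [substBaseChange_C_X, RingHom.comp_apply, RingHom.comp_apply, substBaseChange_C_X, substBaseChange_map φ Φ hX hC])
    (by rw [substBaseChange_X, RingHom.comp_apply, substBaseChange_X, substBaseChange_X])

/-- **Inverses base-change** (ours): `Φ ∘ Ψ = id` (`Φ` fixing scalars and `σ`) ⇒ `Φ_R ∘ Ψ_R = id`.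
[cite: SerreLocalFields1979, Ch. II §4 Lemma 1] -/
theorem substBaseChange_comp_eq_id (Φ Ψ : (MvPolynomial ι k)[X] →+* (MvPolynomial ι k)[X]) (hX : Φ X = X)
    (hC : ∀ c : k, Φ (C (MvPolynomial.C c)) = C (MvPolynomial.C c)) (hΘ : Φ.comp Ψ = RingHom.id _) :
    (substBaseChange φ Φ).comp (substBaseChange φ Ψ) = RingHom.id _ := by
  rw [← substBaseChange_comp φ Φ Ψ hX hC, hΘ, substBaseChange_id]

/-- **Isotropies base-change** (ours; engine §1 (F2)): `Φ (C g) = C g`, `Φ` fixing scalars and `σ` ⇒ `Φ_R (C g^φ) = C g^φ`.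
[cite: SerreLocalFields1979, Ch. II §4 Lemma 1] -/
theorem isIsotropyOf_substBaseChange {g : MvPolynomial ι k} {Φ : (MvPolynomial ι k)[X] →+* (MvPolynomial ι k)[X]}
    (hΦ : IsIsotropyOf g Φ) (hX : Φ X = X) (hC : ∀ c : k, Φ (C (MvPolynomial.C c)) = C (MvPolynomial.C c)) :
    IsIsotropyOf (MvPolynomial.map φ g) (substBaseChange φ Φ) := by
  unfold IsIsotropyOf at hΦ ⊢
  rw [← Polynomial.map_C, substBaseChange_map φ Φ hX hC, hΦ, Polynomial.map_C]

/-- `(·)^φ` maps the ideal `(σ)` into `(σ)` (bookkeeping). [cite: SerreLocalFields1979, Ch. II §4 Lemma 1] -/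
theorem map_mem_span_X {f : (MvPolynomial ι k)[X]} (hf : f ∈ Ideal.span {(X : (MvPolynomial ι k)[X])}) :
    f.map (MvPolynomial.map φ) ∈ Ideal.span {(X : (MvPolynomial ι R)[X])} := by
  obtain ⟨g, rfl⟩ := Ideal.mem_span_singleton'.mp hf
  rw [Polynomial.map_mul, Polynomial.map_X]
  exact Ideal.mul_mem_left _ _ (Ideal.mem_span_singleton_self X)

/-- **`Φ ≡ id (mod σ)` ⇒ `Φ_R ≡ id (mod σ)`** (ours, bookkeeping). [cite: SerreLocalFields1979, Ch. II §4 Lemma 1] -/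
theorem substBaseChange_sub_self_mem (Φ : (MvPolynomial ι k)[X] →+* (MvPolynomial ι k)[X])
    (hΦ : ∀ f, Φ f - f ∈ Ideal.span {(X : (MvPolynomial ι k)[X])}) (F : (MvPolynomial ι R)[X]) :
    substBaseChange φ Φ F - F ∈ Ideal.span {(X : (MvPolynomial ι R)[X])} := by
  refine sub_self_mem_of_forall_C (substBaseChange φ Φ) _ ?_ (fun a => ?_) F
  · rw [substBaseChange_X, sub_self]
    exact zero_mem _
  · induction a using MvPolynomial.induction_on with
    | C r =>
      rw [substBaseChange_C_C, sub_self]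
      exact zero_mem _
    | add p q hp hq =>
      have h : substBaseChange φ Φ (C (p + q)) - C (p + q) =
          (substBaseChange φ Φ (C p) - C p) + (substBaseChange φ Φ (C q) - C q) := by
        rw [map_add, map_add]; abel
      rw [h]
      exact add_mem hp hq
    | mul_X p i hp =>
      have h : substBaseChange φ Φ (C (p * MvPolynomial.X i)) - C (p * MvPolynomial.X i) =
          (substBaseChange φ Φ (C p) - C p) * substBaseChange φ Φ (C (MvPolynomial.X i)) +
            C p * (substBaseChange φ Φ (C (MvPolynomial.X i)) - C (MvPolynomial.X i)) := by
        rw [map_mul, map_mul]; ring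
      rw [h]
      refine add_mem (Ideal.mul_mem_right _ _ hp) (Ideal.mul_mem_left _ _ ?_)
      rw [substBaseChange_C_X, ← MvPolynomial.map_X φ i, ← Polynomial.map_C, ← Polynomial.map_sub]
      exact map_mem_span_X φ (hΦ _)

/-! ## Pure vectors, component operators, gradedness -/

/-- The pure part commutes with base change (bookkeeping). [cite: SerreLocalFields1979, Ch. II §4 Lemma 1] -/
theorem pureMap_map_map (F : (MvPolynomial ι k)[X]) : pureMap (F.map (MvPolynomial.map φ)) = (pureMap F).map φ := by
  rw [pureMap_apply, pureMap_apply, Polynomial.map_map, Polynomial.map_map, MvPolynomial.constantCoeff_comp_map]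

/-- **`pureVec Φ_R i = (pureVec Φ i)^φ`** (ours): base change maps pure vectors coefficientwise by `φ`.
[cite: SerreLocalFields1979, Ch. II §4 Lemma 1] -/
theorem pureVec_substBaseChange (Φ : (MvPolynomial ι k)[X] →+* (MvPolynomial ι k)[X]) (i : ι) :
    pureVec (substBaseChange φ Φ) i = (pureVec Φ i).map φ := by
  rw [pureVec_apply, substBaseChange_C_X, pureMap_map_map, pureVec_apply]

/-- … coefficientwise (ours). [cite: SerreLocalFields1979, Ch. II §4 Lemma 1] -/
theorem coeff_pureVec_substBaseChange (Φ : (MvPolynomial ι k)[X] →+* (MvPolynomial ι k)[X]) (i : ι) (n : ℕ) :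
    (pureVec (substBaseChange φ Φ) i).coeff n = φ ((pureVec Φ i).coeff n) := by
  rw [pureVec_substBaseChange, Polynomial.coeff_map]

/-- Pure-free slots stay pure-free (ours). [cite: SerreLocalFields1979, Ch. II §4 Lemma 1] -/
theorem pureVec_substBaseChange_eq_zero {Φ : (MvPolynomial ι k)[X] →+* (MvPolynomial ι k)[X]} {i : ι} (h : pureVec Φ i = 0) :
    pureVec (substBaseChange φ Φ) i = 0 := by
  rw [pureVec_substBaseChange, h, Polynomial.map_zero]

/-- For `φ` injective, non-zero pure vectors stay non-zero (ours). [cite: SerreLocalFields1979, Ch. II §4 Lemma 1] -/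
theorem pureVec_substBaseChange_ne_zero (hφ : Function.Injective φ) {Φ : (MvPolynomial ι k)[X] →+* (MvPolynomial ι k)[X]}
    {i : ι} (h : pureVec Φ i ≠ 0) : pureVec (substBaseChange φ Φ) i ≠ 0 := by
  rw [pureVec_substBaseChange]
  exact fun h0 => h (Polynomial.map_injective φ hφ (by rw [h0, Polynomial.map_zero]))

/-- **Component operators base-change**: `(Φ_R (C a^φ))_n = ((Φ (C a))_n)^φ` (ours; `E^R_n ∘ φ = φ ∘ E_n`).
[cite: SerreLocalFields1979, Ch. II §4 Lemma 1] -/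
theorem coeff_substBaseChange_C_map (Φ : (MvPolynomial ι k)[X] →+* (MvPolynomial ι k)[X]) (hX : Φ X = X)
    (hC : ∀ c : k, Φ (C (MvPolynomial.C c)) = C (MvPolynomial.C c)) (a : MvPolynomial ι k) (n : ℕ) :
    (substBaseChange φ Φ (C (MvPolynomial.map φ a))).coeff n = MvPolynomial.map φ ((Φ (C a)).coeff n) := by
  rw [← Polynomial.map_C, substBaseChange_map φ Φ hX hC, Polynomial.coeff_map]

/-- **Descent** (ours; LEMMA FC (B5)→(B6)): for `φ` injective, `(Φ_R (C a^φ))_n = 0 ⇒ (Φ (C a))_n = 0`.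
[cite: SerreLocalFields1979, Ch. II §4 Lemma 1] -/
theorem coeff_map_C_eq_zero_of_substBaseChange (hφ : Function.Injective φ) (Φ : (MvPolynomial ι k)[X] →+* (MvPolynomial ι k)[X])
    (hX : Φ X = X) (hC : ∀ c : k, Φ (C (MvPolynomial.C c)) = C (MvPolynomial.C c)) {a : MvPolynomial ι k} {n : ℕ}
    (h : (substBaseChange φ Φ (C (MvPolynomial.map φ a))).coeff n = 0) : (Φ (C a)).coeff n = 0 := by
  rw [coeff_substBaseChange_C_map φ Φ hX hC] at h
  exact MvPolynomial.map_injective φ hφ (by rw [h, map_zero])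

end SubstBaseChange

section Graded

variable {k : Type*} [CommRing k] {R : Type*} [CommRing R] (φ : k →+* R) {ι : Type*} {M : Type*} [AddCommGroup M]
  {w : ι → M} {ρ : M}

/-- Base change preserves weighted homogeneity (bookkeeping). [cite: AbramovichTemkinWlodarczyk2024, Thm. 5.3.1 (2)–(3) (p. 1578)] -/
theorem isWeightedHomogeneous_map {n : M} {p : MvPolynomial ι k} (hp : MvPolynomial.IsWeightedHomogeneous w p n) :
    MvPolynomial.IsWeightedHomogeneous w (MvPolynomial.map φ p) n := fun d hd => by
  rw [MvPolynomial.coeff_map] at hd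
  exact hp fun h0 => hd (by rw [h0, map_zero])

/-- Base change preserves total-weight homogeneity (bookkeeping). [cite: AbramovichTemkinWlodarczyk2024, Thm. 5.3.1 (2)–(3) (p. 1578)] -/
theorem isTW_map {n : M} {f : (MvPolynomial ι k)[X]} (hf : IsTW w ρ n f) : IsTW w ρ n (f.map (MvPolynomial.map φ)) := fun s => by
  rw [Polynomial.coeff_map]
  exact isWeightedHomogeneous_map φ (hf s)

/-- **`Φ` graded of degree `ρ` ⇒ `Φ_R` graded of degree `ρ`** (same weights) (ours; engine §1 (F2)).
[cite: AbramovichTemkinWlodarczyk2024, Thm. 5.3.1 (2)–(3) (p. 1578)] -/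
theorem isGradedHom_substBaseChange {Φ : (MvPolynomial ι k)[X] →+* (MvPolynomial ι k)[X]} (hΦ : IsGradedHom w ρ Φ) :
    IsGradedHom w ρ (substBaseChange φ Φ) where
  map_C_C r := substBaseChange_C_C φ Φ r
  isTW_X := by rw [substBaseChange_X]; exact isTW_X
  isTW_CX i := by rw [substBaseChange_C_X]; exact isTW_map φ (hΦ.isTW_CX i)

end Graded

end Literature.AlgebraicGeometry.Resolution.WeightedBlowup
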